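import Mathlib
import Summits.CriticalPhenomena.PercolationContinuityZ3.Theorems.PercNearOneGluingNoHeavyLowerTailOrientedAntipodalHall

/-!
# Chain classes of antipodal bads: reduction of capacity-one Hall to a two-family Marica–Schönheim count

Helper file for crux `stmt-CriticalPhenomena-4575` (`NoHeavyLowerTail`, route `PercNearOneGluingNoHeavy`),
factory seat `prim-ineq-gen-3` (gen 3); companion of
`PercNearOneGluingNoHeavyLowerTailOrientedAntipodalHall` (separated classes, proved there outright).

A *chain* pair of ordered bad types is `(i,j), (j,l)`: the middle petal `j` is the complement label of the
first class and the set label of the second, so the pair is not separated and the Marica–Schönheim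
argument of the companion file does not apply verbatim.  What survives (`card_add_card_le_card_goods_above_chain`):
for `A, A'` of type `(i,j)` and `B, B'` of type `(j,l)` the sets `A ∪ (S \ A')`, `A ∪ B`, `B' ∪ (S \ B)` are
good and contain a member of the family, and they are the complements in `S` of the members of
`(𝒞 \\ 𝒞) ∪ (𝒞 \\ ℬ) ∪ (ℬ \\ ℬ)` with `𝒞 = {S \ A}`, `ℬ = {B}`.  Hence the capacity-one Hall count for a chain
class follows from the purely set-theoretic inequality
`#𝒞 + #ℬ ≤ #((𝒞 \\ 𝒞) ∪ (𝒞 \\ ℬ) ∪ (ℬ \\ ℬ))`, which is taken here as a HYPOTHESIS (`hMS`).  That inequality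
— Marica–Schönheim for `𝒞 ∪ ℬ` with the block `ℬ \\ 𝒞` dropped — is conjectured to hold whenever no member of
`𝒞` is contained in a member of `ℬ` (here automatic: `S \ A ⊆ B` would force `C_l ≤ C_i`); it is verified
exhaustively for ground sets of size ≤ 4 (all 1 999 873 such pairs of families) but not proved, so this file
proves only the reductions: `card_add_card_le_card_goods_above_chain` (one chain pair, modulo the two-family
inequality `MS2′`) and `card_le_card_goods_above_transitive` (a whole transitive orientation selection, modulo
the three-family inequality `MS3′`, of which `MS2′` is the case of an empty middle family).  (prim-ineq-gen-3, 2026-08-20; memo `run/shared/lean/prim/prim-ineq-gen-3/COMB.md`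
§3c (xi).)
-/

namespace Summit.CriticalPhenomena.PercolationContinuityZ3.Theorems

namespace OrientedAntipodalHall

open Finset AntipodalStrongHarris AntipodalStrongHarris.Lab
open scoped FinsetFamily

variable {α : Type*} [DecidableEq α] {k : ℕ}

/-- **Chain classes: Hall count modulo the two-family Marica–Schönheim inequality.**  Let `f` be a
sunflower labeling, `D₁` a family of antipodal bads of type `(i,j)` and `D₂` of type `(j,l)` inside `S`
(`i ≠ j`, `j ≠ l`).  If the families `𝒞 = {S \ A : A ∈ D₁}` and `ℬ = D₂` satisfy
`#𝒞 + #ℬ ≤ #((𝒞 \\ 𝒞) ∪ (𝒞 \\ ℬ) ∪ (ℬ \\ ℬ))`, then at least `#D₁ + #D₂` good sets `U ⊆ S` contain a member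
of `D₁ ∪ D₂`. -/
theorem card_add_card_le_card_goods_above_chain (S : Finset α) {f : Finset α → Lab k}
    (hf : ∀ ⦃X Y : Finset α⦄, X ⊆ Y → f X ≤ f Y) (D₁ D₂ : Finset (Finset α)) {i j l : Fin k}
    (hij : i ≠ j) (hjl : j ≠ l)
    (h₁S : ∀ A ∈ D₁, A ⊆ S) (h₁i : ∀ A ∈ D₁, f A = petal i) (h₁j : ∀ A ∈ D₁, f (S \ A) = petal j)
    (h₂S : ∀ B ∈ D₂, B ⊆ S) (h₂j : ∀ B ∈ D₂, f B = petal j) (h₂l : ∀ B ∈ D₂, f (S \ B) = petal l)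
    (hMS : #(D₁.image fun A => S \ A) + #D₂ ≤
      #(((D₁.image fun A => S \ A) \\ (D₁.image fun A => S \ A)) ∪
        ((D₁.image fun A => S \ A) \\ D₂) ∪ (D₂ \\ D₂))) :
    #D₁ + #D₂ ≤ #{U ∈ S.powerset | f U = top ∧ f (S \ U) = bot ∧ ∃ X ∈ D₁ ∪ D₂, X ⊆ U} := by
  set 𝒞 : Finset (Finset α) := D₁.image fun A => S \ A with h𝒞
  set E : Finset (Finset α) := (𝒞 \\ 𝒞) ∪ (𝒞 \\ D₂) ∪ (D₂ \\ D₂) with hE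
  -- `A ↦ S \ A` is injective on `D₁`
  have hc1 : #𝒞 = #D₁ := by
    rw [h𝒞]
    refine card_image_of_injOn ?_
    intro A hA A' hA' h
    have e₁ := Finset.sdiff_sdiff_eq_self (h₁S A hA)
    have e₂ := Finset.sdiff_sdiff_eq_self (h₁S A' hA')
    simp only at h
    rw [← e₁, ← e₂, h]
  -- members of `E` are subsets of `S`
  have hEsub : ∀ T ∈ E, T ⊆ S := by
    intro T hT
    rw [hE, mem_union, mem_union] at hT
    rcases hT with (hT | hT) | hT
    · obtain ⟨C, hC, C', -, rfl⟩ := mem_diffs.mp hT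
      obtain ⟨A, -, rfl⟩ := mem_image.mp hC
      exact sdiff_subset.trans sdiff_subset
    · obtain ⟨C, hC, B, -, rfl⟩ := mem_diffs.mp hT
      obtain ⟨A, -, rfl⟩ := mem_image.mp hC
      exact sdiff_subset.trans sdiff_subset
    · obtain ⟨B, hB, B', -, rfl⟩ := mem_diffs.mp hT
      exact sdiff_subset.trans (h₂S B hB)
  have hinj : Set.InjOn (fun T => S \ T) (E : Set (Finset α)) := by
    intro T₁ hT₁ T₂ hT₂ h
    have e₁ := Finset.sdiff_sdiff_eq_self (hEsub T₁ hT₁)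
    have e₂ := Finset.sdiff_sdiff_eq_self (hEsub T₂ hT₂)
    simp only at h
    rw [← e₁, ← e₂, h]
  -- the complements of members of `E` are good sets above a member of `D₁ ∪ D₂`
  have himg : E.image (fun T => S \ T) ⊆
      {U ∈ S.powerset | f U = top ∧ f (S \ U) = bot ∧ ∃ X ∈ D₁ ∪ D₂, X ⊆ U} := by
    intro U hU
    obtain ⟨T, hT, rfl⟩ := mem_image.mp hU
    rw [mem_filter, mem_powerset]
    refine ⟨sdiff_subset, ?_⟩
    rw [Finset.sdiff_sdiff_eq_self (hEsub T hT)]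
    rw [hE, mem_union, mem_union] at hT
    rcases hT with (hT | hT) | hT
    · -- T = (S \ A) \ (S \ A') = A' \ A ;  S \ T ⊇ A and ⊇ S \ A'
      obtain ⟨C, hC, C', hC', rfl⟩ := mem_diffs.mp hT
      obtain ⟨A, hA, rfl⟩ := mem_image.mp hC
      obtain ⟨A', hA', rfl⟩ := mem_image.mp hC'
      have hAS := h₁S A hA
      have hA'S := h₁S A' hA'
      have hsupA : A ⊆ S \ ((S \ A) \ (S \ A')) := by
        intro a ha
        exact mem_sdiff.mpr ⟨hAS ha, fun h => (mem_sdiff.mp (mem_sdiff.mp h).1).2 ha⟩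
      have hTA' : (S \ A) \ (S \ A') ⊆ A' := by
        intro a ha
        rw [mem_sdiff, mem_sdiff, mem_sdiff] at ha
        by_contra h
        exact ha.2 ⟨ha.1.1, h⟩
      have hsupA' : S \ A' ⊆ S \ ((S \ A) \ (S \ A')) :=
        sdiff_subset_sdiff le_rfl hTA'
      refine ⟨?_, ?_, ⟨A, mem_union_left _ hA, hsupA⟩⟩
      · refine eq_top_of_petal_le hij ?_ ?_
        · rw [← h₁i A hA]; exact hf hsupA
        · rw [← h₁j A' hA']; exact hf hsupA'
      · refine eq_bot_of_le_petal hij ?_ ?_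
        · rw [← h₁i A' hA']; exact hf hTA'
        · rw [← h₁j A hA]; exact hf sdiff_subset
    · -- T = (S \ A) \ B ;  S \ T = A ∪ B (inside S)
      obtain ⟨C, hC, B, hB, rfl⟩ := mem_diffs.mp hT
      obtain ⟨A, hA, rfl⟩ := mem_image.mp hC
      have hAS := h₁S A hA
      have hBS := h₂S B hB
      have hsupA : A ⊆ S \ ((S \ A) \ B) := by
        intro a ha
        exact mem_sdiff.mpr ⟨hAS ha, fun h => (mem_sdiff.mp (mem_sdiff.mp h).1).2 ha⟩
      have hsupB : B ⊆ S \ ((S \ A) \ B) := by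
        intro b hb
        exact mem_sdiff.mpr ⟨hBS hb, fun h => (mem_sdiff.mp h).2 hb⟩
      refine ⟨?_, ?_, ⟨A, mem_union_left _ hA, hsupA⟩⟩
      · refine eq_top_of_petal_le hij ?_ ?_
        · rw [← h₁i A hA]; exact hf hsupA
        · rw [← h₂j B hB]; exact hf hsupB
      · refine eq_bot_of_le_petal hjl ?_ ?_
        · rw [← h₁j A hA]; exact hf sdiff_subset
        · rw [← h₂l B hB]; exact hf (sdiff_subset_sdiff sdiff_subset le_rfl)
    · -- T = B \ B' ;  S \ T ⊇ B' and ⊇ S \ B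
      obtain ⟨B, hB, B', hB', rfl⟩ := mem_diffs.mp hT
      have hBS := h₂S B hB
      have hB'S := h₂S B' hB'
      have hsupB' : B' ⊆ S \ (B \ B') := by
        intro b hb
        exact mem_sdiff.mpr ⟨hB'S hb, fun h => (mem_sdiff.mp h).2 hb⟩
      have hsupB : S \ B ⊆ S \ (B \ B') := sdiff_subset_sdiff le_rfl sdiff_subset
      refine ⟨?_, ?_, ⟨B', mem_union_right _ hB', hsupB'⟩⟩
      · refine eq_top_of_petal_le hjl ?_ ?_
        · rw [← h₂j B' hB']; exact hf hsupB'
        · rw [← h₂l B hB]; exact hf hsupB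
      · refine eq_bot_of_le_petal hjl ?_ ?_
        · rw [← h₂j B hB]; exact hf sdiff_subset
        · rw [← h₂l B' hB']; exact hf (sdiff_subset_sdiff hBS le_rfl)
  calc #D₁ + #D₂ = #𝒞 + #D₂ := by rw [hc1]
    _ ≤ #E := hMS
    _ = #(E.image fun T => S \ T) := (card_image_of_injOn hinj).symm
    _ ≤ _ := card_le_card himg

/-- Helper: if `P, Q ⊆ S` carry petal labels `f Q = C_a`, `f (S \ P) = C_b` with `a ≠ b` and
`f P = C_c`, `f (S \ Q) = C_d` with `c ≠ d`, then `S \ (P \ Q)` is a good set containing `Q`. -/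
theorem good_compl_diff (S : Finset α) {f : Finset α → Lab k}
    (hf : ∀ ⦃X Y : Finset α⦄, X ⊆ Y → f X ≤ f Y) {P Q : Finset α} (hPS : P ⊆ S) (hQS : Q ⊆ S)
    {a b c d : Fin k} (hab : a ≠ b) (hcd : c ≠ d) (hQ : f Q = petal a) (hSP : f (S \ P) = petal b)
    (hP : f P = petal c) (hSQ : f (S \ Q) = petal d) :
    f (S \ (P \ Q)) = top ∧ f (S \ (S \ (P \ Q))) = bot ∧ Q ⊆ S \ (P \ Q) := by
  have hQsub : Q ⊆ S \ (P \ Q) := by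
    intro q hq
    exact mem_sdiff.mpr ⟨hQS hq, fun h => (mem_sdiff.mp h).2 hq⟩
  refine ⟨?_, ?_, hQsub⟩
  · refine eq_top_of_petal_le hab ?_ ?_
    · rw [← hQ]; exact hf hQsub
    · rw [← hSP]; exact hf (sdiff_subset_sdiff le_rfl sdiff_subset)
  · rw [Finset.sdiff_sdiff_eq_self (sdiff_subset.trans hPS)]
    refine eq_bot_of_le_petal hcd ?_ ?_
    · rw [← hP]; exact hf sdiff_subset
    · rw [← hSQ]; exact hf (sdiff_subset_sdiff hPS le_rfl)

/-- **Transitive (ascending) selections: Hall count modulo the three-family Marica–Schönheim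
inequality `MS3′`.**  Let `f` be a sunflower labeling and `D₁, D₂, D₃` families of antipodal bads inside
`S` of types `(i,j)`, `(i,l)`, `(j,l)` (`i, j, l` distinct) — an ascending orientation selection.  If
`#D₁ + #D₂ + #D₃ ≤ #(((D₁ ∪ D₂) \\ (D₁ ∪ D₂)) ∪ ((D₂ ∪ D₃) \\ (D₂ ∪ D₃)) ∪ ({S \ A : A ∈ D₁} \\ D₃))`
(the instance of conjecture `MS3′`; its hypothesis `A ∪ B ≠ S` for `A ∈ D₁, B ∈ D₃` is automatic here),
then at least `#D₁ + #D₂ + #D₃` good sets `U ⊆ S` contain a member of `D₁ ∪ D₂ ∪ D₃` — capacity-one Hall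
for the whole selection, hence (with the opposite selection) the localized antipodal inequality `LOC-P₂`. -/
theorem card_le_card_goods_above_transitive (S : Finset α) {f : Finset α → Lab k}
    (hf : ∀ ⦃X Y : Finset α⦄, X ⊆ Y → f X ≤ f Y) (D₁ D₂ D₃ : Finset (Finset α)) {i j l : Fin k}
    (hij : i ≠ j) (hil : i ≠ l) (hjl : j ≠ l)
    (h₁S : ∀ A ∈ D₁, A ⊆ S) (h₁i : ∀ A ∈ D₁, f A = petal i) (h₁j : ∀ A ∈ D₁, f (S \ A) = petal j)
    (h₂S : ∀ A ∈ D₂, A ⊆ S) (h₂i : ∀ A ∈ D₂, f A = petal i) (h₂l : ∀ A ∈ D₂, f (S \ A) = petal l)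
    (h₃S : ∀ B ∈ D₃, B ⊆ S) (h₃j : ∀ B ∈ D₃, f B = petal j) (h₃l : ∀ B ∈ D₃, f (S \ B) = petal l)
    (hMS3 : #D₁ + #D₂ + #D₃ ≤
      #(((D₁ ∪ D₂) \\ (D₁ ∪ D₂)) ∪ ((D₂ ∪ D₃) \\ (D₂ ∪ D₃)) ∪ ((D₁.image fun A => S \ A) \\ D₃))) :
    #D₁ + #D₂ + #D₃ ≤
      #{U ∈ S.powerset | f U = top ∧ f (S \ U) = bot ∧ ∃ X ∈ D₁ ∪ D₂ ∪ D₃, X ⊆ U} := by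
  set E : Finset (Finset α) :=
    ((D₁ ∪ D₂) \\ (D₁ ∪ D₂)) ∪ ((D₂ ∪ D₃) \\ (D₂ ∪ D₃)) ∪ ((D₁.image fun A => S \ A) \\ D₃) with hE
  have h12S : ∀ P ∈ D₁ ∪ D₂, P ⊆ S := by
    intro P hP; rcases mem_union.mp hP with hP | hP
    exacts [h₁S P hP, h₂S P hP]
  have h23S : ∀ P ∈ D₂ ∪ D₃, P ⊆ S := by
    intro P hP; rcases mem_union.mp hP with hP | hP
    exacts [h₂S P hP, h₃S P hP]
  -- members of `E` are subsets of `S`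
  have hEsub : ∀ T ∈ E, T ⊆ S := by
    intro T hT
    rw [hE, mem_union, mem_union] at hT
    rcases hT with (hT | hT) | hT
    · obtain ⟨P, hP, Q, -, rfl⟩ := mem_diffs.mp hT
      exact sdiff_subset.trans (h12S P hP)
    · obtain ⟨P, hP, Q, -, rfl⟩ := mem_diffs.mp hT
      exact sdiff_subset.trans (h23S P hP)
    · obtain ⟨C, hC, B, -, rfl⟩ := mem_diffs.mp hT
      obtain ⟨A, -, rfl⟩ := mem_image.mp hC
      exact sdiff_subset.trans sdiff_subset
  have hinj : Set.InjOn (fun T => S \ T) (E : Set (Finset α)) := by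
    intro T₁ hT₁ T₂ hT₂ h
    have e₁ := Finset.sdiff_sdiff_eq_self (hEsub T₁ hT₁)
    have e₂ := Finset.sdiff_sdiff_eq_self (hEsub T₂ hT₂)
    simp only at h
    rw [← e₁, ← e₂, h]
  have himg : E.image (fun T => S \ T) ⊆
      {U ∈ S.powerset | f U = top ∧ f (S \ U) = bot ∧ ∃ X ∈ D₁ ∪ D₂ ∪ D₃, X ⊆ U} := by
    intro U hU
    obtain ⟨T, hT, rfl⟩ := mem_image.mp hU
    rw [mem_filter, mem_powerset]
    refine ⟨sdiff_subset, ?_⟩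
    rw [hE, mem_union, mem_union] at hT
    rcases hT with (hT | hT) | hT
    · -- first star: P, Q ∈ D₁ ∪ D₂ (set label `i`; complement label `j` or `l`)
      obtain ⟨P, hP, Q, hQ, rfl⟩ := mem_diffs.mp hT
      have hPS := h12S P hP
      have hQS := h12S Q hQ
      have hPi : f P = petal i := by
        rcases mem_union.mp hP with h | h
        exacts [h₁i P h, h₂i P h]
      have hQi : f Q = petal i := by
        rcases mem_union.mp hQ with h | h
        exacts [h₁i Q h, h₂i Q h]
      have hQD : Q ∈ D₁ ∪ D₂ ∪ D₃ := mem_union_left _ hQ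
      rcases mem_union.mp hP with hP' | hP' <;> rcases mem_union.mp hQ with hQ' | hQ'
      · obtain ⟨h1, h2, h3⟩ := good_compl_diff S hf hPS hQS hij hij hQi (h₁j P hP') hPi (h₁j Q hQ')
        exact ⟨h1, h2, Q, hQD, h3⟩
      · obtain ⟨h1, h2, h3⟩ := good_compl_diff S hf hPS hQS hij hil hQi (h₁j P hP') hPi (h₂l Q hQ')
        exact ⟨h1, h2, Q, hQD, h3⟩
      · obtain ⟨h1, h2, h3⟩ := good_compl_diff S hf hPS hQS hil hij hQi (h₂l P hP') hPi (h₁j Q hQ')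
        exact ⟨h1, h2, Q, hQD, h3⟩
      · obtain ⟨h1, h2, h3⟩ := good_compl_diff S hf hPS hQS hil hil hQi (h₂l P hP') hPi (h₂l Q hQ')
        exact ⟨h1, h2, Q, hQD, h3⟩
    · -- second star: P, Q ∈ D₂ ∪ D₃ (complement label `l`; set label `i` or `j`)
      obtain ⟨P, hP, Q, hQ, rfl⟩ := mem_diffs.mp hT
      have hPS := h23S P hP
      have hQS := h23S Q hQ
      have hPl : f (S \ P) = petal l := by
        rcases mem_union.mp hP with h | h
        exacts [h₂l P h, h₃l P h]
      have hQl : f (S \ Q) = petal l := by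
        rcases mem_union.mp hQ with h | h
        exacts [h₂l Q h, h₃l Q h]
      have hQD : Q ∈ D₁ ∪ D₂ ∪ D₃ := by
        rcases mem_union.mp hQ with h | h
        exacts [mem_union_left _ (mem_union_right _ h), mem_union_right _ h]
      rcases mem_union.mp hP with hP' | hP' <;> rcases mem_union.mp hQ with hQ' | hQ'
      · obtain ⟨h1, h2, h3⟩ := good_compl_diff S hf hPS hQS hil hil (h₂i Q hQ') hPl (h₂i P hP') hQl
        exact ⟨h1, h2, Q, hQD, h3⟩
      · obtain ⟨h1, h2, h3⟩ := good_compl_diff S hf hPS hQS hjl hil (h₃j Q hQ') hPl (h₂i P hP') hQl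
        exact ⟨h1, h2, Q, hQD, h3⟩
      · obtain ⟨h1, h2, h3⟩ := good_compl_diff S hf hPS hQS hil hjl (h₂i Q hQ') hPl (h₃j P hP') hQl
        exact ⟨h1, h2, Q, hQD, h3⟩
      · obtain ⟨h1, h2, h3⟩ := good_compl_diff S hf hPS hQS hjl hjl (h₃j Q hQ') hPl (h₃j P hP') hQl
        exact ⟨h1, h2, Q, hQD, h3⟩
    · -- chain pair: T = (S \ A) \ B, complement A ∪ B
      obtain ⟨C, hC, B, hB, rfl⟩ := mem_diffs.mp hT
      obtain ⟨A, hA, rfl⟩ := mem_image.mp hC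
      have hAS := h₁S A hA
      have hBS := h₃S B hB
      rw [Finset.sdiff_sdiff_eq_self (sdiff_subset.trans sdiff_subset : (S \ A) \ B ⊆ S)]
      have hsupA : A ⊆ S \ ((S \ A) \ B) := by
        intro a ha
        exact mem_sdiff.mpr ⟨hAS ha, fun h => (mem_sdiff.mp (mem_sdiff.mp h).1).2 ha⟩
      have hsupB : B ⊆ S \ ((S \ A) \ B) := by
        intro b hb
        exact mem_sdiff.mpr ⟨hBS hb, fun h => (mem_sdiff.mp h).2 hb⟩
      refine ⟨?_, ?_, ⟨A, mem_union_left _ (mem_union_left _ hA), hsupA⟩⟩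
      · refine eq_top_of_petal_le hij ?_ ?_
        · rw [← h₁i A hA]; exact hf hsupA
        · rw [← h₃j B hB]; exact hf hsupB
      · refine eq_bot_of_le_petal hjl ?_ ?_
        · rw [← h₁j A hA]; exact hf sdiff_subset
        · rw [← h₃l B hB]; exact hf (sdiff_subset_sdiff sdiff_subset le_rfl)
  calc #D₁ + #D₂ + #D₃ ≤ #E := hMS3
    _ = #(E.image fun T => S \ T) := (card_image_of_injOn hinj).symm
    _ ≤ _ := card_le_card himg

end OrientedAntipodalHall

end Summit.CriticalPhenomena.PercolationContinuityZ3.Theorems
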